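import Literature.Probability.Percolation.ZdPivotalFourArm
import Literature.Probability.Percolation.RSW
import Literature.Probability.Percolation.Z2PivotalMeasure
import HarnessLib

/-!
# Re-rooting four arms of `A_{1,N}` at the edge `s(0, e₀)` (bond percolation on `ℤ²`)

Topic `Literature/Probability/Percolation`; proofs and three auxiliary definitions (`unitRingPt`,
`edgesNearOrigin`, `rerootingEdges`; no named fact).
Deterministic half of the comparison

  `P_{1/2}(fourArmTwoClusters 1 N) ≤ C · P_{1/2}(edgeFourArm [-N,N]² 0 0)`

(`ZdFourArmQuasiMultProofs.lean`) between the tree's two cluster-form renderings of "four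
alternating arms from the centre to distance `N`" for bond percolation on `ℤ²`: the annulus form
`fourArmTwoClusters 1 N` of `FourArmGarban.lean` (two open crossings of `A_{1,N} = [-N,N]² ∖ {0}`
lying in distinct open clusters of the annulus) and the edge form `edgeFourArm [-N,N]² 0 0` of
`Z2PivotalMeasure.lean` (Garban–Pete–Schramm's "four arms from a single bit", GPS 2013 §2.1: in
`ω ∖ {e}`, `e = s(0, e₀)`, both endpoints of `e` are joined to `∂[-N,N]²` and not to each other).
Kesten (1987, §2, (2.13)–(2.15) and Lemma 2 with its "connections within a bounded set can be
rearranged at bounded cost") and Nolin (2008, §4.1: "for any fixed `n₁, n₂ ≥ n₀(j)`,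
`P̂(A_{j,σ}(n₁,N)) ≍ P̂(A_{j,σ}(n₂,N))`") treat the choice of the inner radius / of the central bit
as immaterial; this file supplies the lattice surgery behind that remark in the one case the
tree needs:

* `unitRingPt k` — the eight sites of the sup-norm sphere `{‖v‖_∞ = 1}` in cyclic order from
  `e₀ = (1,0)`, with the walks along this cycle (`exists_unitRingWalk`) and from the origin
  (`exists_walk_zero_unitRingPt`), and `exists_disjoint_rootingWalks` — **for two distinct sites
  `z, z'` of the sphere there are vertex-disjoint lattice walks inside `[-1,1]²` joining `0` to
  one of them and `e₀` to the other**;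
* `mem_vertexBoundary_box_of_mem_siteSphere` — sites of sup-norm `N` are boundary sites of
  `[-N,N]²`;
* `edgesNearOrigin` — the lattice edges meeting `[-1,1]²` (the modification window), and
  `rerootingEdges` — the edges re-opened by the surgery;
* `mem_edgeFourArm_of_rerooting` — **the surgery**: given two open walks coming from
  `∂[-N,N]²` that stay off `[-1,1]²` until their last steps `wᵢ → zᵢ ∈ [-1,1]²`, whose parts off
  `[-1,1]²` are not joined by an open path of `[-N,N]² ∖ [-1,1]²`, and disjoint rooting walks
  `0 ⇝ z₁`, `e₀ ⇝ z₂` inside `[-1,1]²`, the configuration obtained by closing every edge meeting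
  `[-1,1]²` and then opening the two last steps and the rooting walks lies in
  `edgeFourArm [-N,N]² 0 0` (a cut argument: the set "rooting walk of `0` ∪ annulus-cluster of
  `w₁`" is closed under the open edges of the new configuration and misses `e₀`).

## References

* H. Kesten, *Scaling relations for 2D-percolation*, Comm. Math. Phys. 109 (1987), §2
  [KestenScalingCMP1987].
* P. Nolin, *Near-critical percolation in two dimensions*, EJP 13 (2008), §4.1 (the inner radius
  `n₀(j)` is immaterial) [Nolin2008].
* C. Garban, G. Pete, O. Schramm, JAMS 26 (2013), §2.1 (arm events from a single bit)
  [GarbanPeteSchramm2013Pivotal].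
-/

noncomputable section

namespace Literature.Probability.Percolation

open Set LatticeModels

/-! ### Points of `ℤ²` and the box `[-1,1]²` -/

/-- Adjacency of explicit points of `ℤ²`: `(a,b) ∼ (c,d)` when they differ by a unit coordinate
vector. [folklore] -/
theorem adj_pt_of {a b c d : ℤ}
    (h : (c = a + 1 ∧ d = b) ∨ (a = c + 1 ∧ d = b) ∨ (c = a ∧ d = b + 1) ∨ (c = a ∧ b = d + 1)) :
    (zdGraph 2).Adj (pt a b) (pt c d) := by
  rcases h with ⟨rfl, rfl⟩ | ⟨rfl, rfl⟩ | ⟨rfl, rfl⟩ | ⟨rfl, rfl⟩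
  · exact (zdGraph_adj_iff _ _).2 ⟨0, Or.inl (pt_succ_eq _ _)⟩
  · exact (zdGraph_adj_iff _ _).2 ⟨0, Or.inr (pt_succ_eq _ _)⟩
  · exact (zdGraph_adj_iff _ _).2 ⟨1, Or.inl (by ext k; fin_cases k <;> simp)⟩
  · exact (zdGraph_adj_iff _ _).2 ⟨1, Or.inr (by ext k; fin_cases k <;> simp)⟩

/-- A point with coordinates in `[-1,1]` lies in the box `[-1,1]²`. [folklore] -/
theorem pt_mem_box_one {a b : ℤ} (ha : -1 ≤ a) (ha' : a ≤ 1) (hb : -1 ≤ b) (hb' : b ≤ 1) :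
    pt a b ∈ box 2 1 := by
  rw [mem_box]
  intro i
  fin_cases i <;> simp <;> omega

/-- The origin of `ℤ²` as an explicit point. [folklore] -/
theorem zero_eq_pt : (0 : Site 2) = pt 0 0 := by
  ext k; fin_cases k <;> simp

/-- The endpoint `e₀ = 0 + e₀` of the reference edge as an explicit point. [folklore] -/
theorem zero_add_single_zero_eq_pt : (0 : Site 2) + Pi.single 0 1 = pt 1 0 := by
  ext k; fin_cases k <;> simp

/-! ### The eight neighbours of the origin in sup-norm, as a cycle -/

/-- The `k`-th site of the ring `{‖v‖_∞ = 1}` around the origin, counter-clockwise from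
`e₀ = (1,0)`: `(1,0), (1,1), (0,1), (-1,1), (-1,0), (-1,-1), (0,-1), (1,-1)`; indices `≥ 8` get
the junk value `(1,0)`. [folklore] -/
def unitRingPt : ℕ → Site 2
  | 0 => pt 1 0
  | 1 => pt 1 1
  | 2 => pt 0 1
  | 3 => pt (-1) 1
  | 4 => pt (-1) 0
  | 5 => pt (-1) (-1)
  | 6 => pt 0 (-1)
  | 7 => pt 1 (-1)
  | _ + 8 => pt 1 0

/-- `unitRingPt 0 = e₀`. [folklore] -/
theorem unitRingPt_zero : unitRingPt 0 = (0 : Site 2) + Pi.single 0 1 := by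
  rw [zero_add_single_zero_eq_pt]; rfl

/-- The ring sites lie in `[-1,1]²`. [folklore] -/
theorem unitRingPt_mem_box (k : ℕ) (hk : k < 8) : unitRingPt k ∈ box 2 1 := by
  interval_cases k <;> exact pt_mem_box_one (by norm_num) (by norm_num) (by norm_num) (by norm_num)

/-- The ring sites are not the origin. [folklore] -/
theorem unitRingPt_ne_zero (k : ℕ) (hk : k < 8) : unitRingPt k ≠ 0 := by
  rw [zero_eq_pt]
  interval_cases k <;> simp [unitRingPt, Matrix.vecCons_inj]

/-- The ring sites are pairwise distinct. [folklore] -/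
theorem unitRingPt_injOn {k k' : ℕ} (hk : k < 8) (hk' : k' < 8) (h : unitRingPt k = unitRingPt k') : k = k' := by
  interval_cases k <;> interval_cases k' <;> simp [unitRingPt, Matrix.vecCons_inj] at h ⊢

/-- Consecutive ring sites are lattice neighbours. [folklore] -/
theorem unitRingPt_adj_succ (k : ℕ) (hk : k < 7) : (zdGraph 2).Adj (unitRingPt k) (unitRingPt (k + 1)) := by
  interval_cases k <;> exact adj_pt_of (by norm_num)

/-- The cycle closes up: `(1,-1) ∼ (1,0)`. [folklore] -/
theorem unitRingPt_adj_seven_zero : (zdGraph 2).Adj (unitRingPt 7) (unitRingPt 0) := adj_pt_of (by norm_num)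

/-- The origin is adjacent to the ring sites of index `2`, `4`, `6` (and to `unitRingPt 0 = e₀`).
[folklore] -/
theorem zero_adj_unitRingPt (k : ℕ) (hk : k = 2 ∨ k = 4 ∨ k = 6) : (zdGraph 2).Adj 0 (unitRingPt k) := by
  rw [zero_eq_pt]
  rcases hk with rfl | rfl | rfl <;> exact adj_pt_of (by norm_num)

/-- Every site of the sup-norm sphere `{‖v‖_∞ = 1}` is a ring site. [folklore] -/
theorem exists_unitRingPt_eq {z : Site 2} (hz : z ∈ siteSphere 1) : ∃ k, k < 8 ∧ unitRingPt k = z := by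
  rw [siteSphere, Finset.mem_sdiff, mem_box, Nat.sub_self] at hz
  obtain ⟨hz, hz0⟩ := hz
  have h0 := hz 0
  have h1 := hz 1
  have hz' : z = pt (z 0) (z 1) := by ext i; fin_cases i <;> rfl
  have hne : ¬ (z 0 = 0 ∧ z 1 = 0) := by
    rintro ⟨ha, hb⟩
    apply hz0
    rw [mem_box]
    intro i
    fin_cases i <;> simp [ha, hb]
  rw [hz']
  rcases (show z 0 = -1 ∨ z 0 = 0 ∨ z 0 = 1 by omega) with ha | ha | ha <;>
    rcases (show z 1 = -1 ∨ z 1 = 0 ∨ z 1 = 1 by omega) with hb | hb | hb <;>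
    rw [ha, hb]
  · exact ⟨5, by norm_num, rfl⟩
  · exact ⟨4, by norm_num, rfl⟩
  · exact ⟨3, by norm_num, rfl⟩
  · exact ⟨6, by norm_num, rfl⟩
  · exact absurd ⟨ha, hb⟩ hne
  · exact ⟨2, by norm_num, rfl⟩
  · exact ⟨7, by norm_num, rfl⟩
  · exact ⟨0, by norm_num, rfl⟩
  · exact ⟨1, by norm_num, rfl⟩

/-! ### Walks along the ring and from the origin -/

/-- **The arc of the ring** from index `c` up to index `d` (`c ≤ d ≤ 7`): a lattice walk from
`unitRingPt c` to `unitRingPt d` visiting only ring sites of index in `[c, d]`. [folklore] -/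
theorem exists_unitRingWalk {c d : ℕ} (hcd : c ≤ d) (hd : d ≤ 7) :
    ∃ q : (zdGraph 2).Walk (unitRingPt c) (unitRingPt d),
      ∀ v ∈ q.support, ∃ k, c ≤ k ∧ k ≤ d ∧ v = unitRingPt k := by
  obtain ⟨n, rfl⟩ := Nat.exists_eq_add_of_le hcd
  induction n with
  | zero =>
    refine ⟨SimpleGraph.Walk.nil, fun v hv => ⟨c, le_rfl, le_rfl, ?_⟩⟩
    simpa using hv
  | succ n ih =>
    obtain ⟨q, hq⟩ := ih (by omega) (by omega)
    have hadj : (zdGraph 2).Adj (unitRingPt (c + n)) (unitRingPt (c + n + 1)) :=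
      unitRingPt_adj_succ _ (by omega)
    refine ⟨q.concat hadj, fun v hv => ?_⟩
    rw [SimpleGraph.Walk.support_concat, List.mem_append, List.mem_singleton] at hv
    rcases hv with hv | rfl
    · obtain ⟨k, hk, hk', rfl⟩ := hq v hv
      exact ⟨k, hk, by omega, rfl⟩
    · exact ⟨c + n + 1, by omega, le_rfl, rfl⟩

/-- **The docking walk of `e₀`**: from `e₀ = unitRingPt 0` clockwise, `(1,0), (1,-1), (0,-1), …`, down
to the ring site of index `h`; it visits `unitRingPt 0` and ring sites of index in `[h, 7]` only.
[folklore] -/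
theorem exists_walk_unitRingPt_zero {h : ℕ} (hh' : h ≤ 7) :
    ∃ q : (zdGraph 2).Walk (unitRingPt 0) (unitRingPt h),
      ∀ v ∈ q.support, v = unitRingPt 0 ∨ ∃ k, h ≤ k ∧ k ≤ 7 ∧ v = unitRingPt k := by
  obtain ⟨q, hq⟩ := exists_unitRingWalk hh' le_rfl
  refine ⟨SimpleGraph.Walk.cons unitRingPt_adj_seven_zero.symm q.reverse, fun v hv => ?_⟩
  rw [SimpleGraph.Walk.support_cons, List.mem_cons, SimpleGraph.Walk.support_reverse,
    List.mem_reverse] at hv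
  rcases hv with rfl | hv
  · exact Or.inl rfl
  · exact Or.inr (hq v hv)

/-- The rooting walk of the origin, assembled from a first step `0 → unitRingPt c` (`c` even) and a
ring walk. [folklore] -/
theorem exists_walk_zero_unitRingPt_aux {c t lo hi : ℕ} (hc : c = 2 ∨ c = 4 ∨ c = 6) (hlo : 1 ≤ lo)
    (hhi : hi ≤ t ∨ hi ≤ 2) (W : (zdGraph 2).Walk (unitRingPt c) (unitRingPt t))
    (hW : ∀ v ∈ W.support, ∃ k, lo ≤ k ∧ k ≤ hi ∧ v = unitRingPt k) :
    ∃ q : (zdGraph 2).Walk 0 (unitRingPt t),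
      ∀ v ∈ q.support, v = 0 ∨ ∃ k, 1 ≤ k ∧ (k ≤ t ∨ k ≤ 2) ∧ v = unitRingPt k := by
  refine ⟨SimpleGraph.Walk.cons (zero_adj_unitRingPt c hc) W, fun v hv => ?_⟩
  rw [SimpleGraph.Walk.support_cons, List.mem_cons] at hv
  rcases hv with rfl | hv
  · exact Or.inl rfl
  · obtain ⟨k, hk, hk', rfl⟩ := hW v hv
    exact Or.inr ⟨k, by omega, by omega, rfl⟩

/-- **The rooting walk of the origin**: for `1 ≤ t ≤ 7` a lattice walk from `0` to `unitRingPt t`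
avoiding `e₀ = unitRingPt 0`, through ring sites of index in `[1, max(t, 2)]` only (first step to the
nearest of `(0,1), (-1,0), (0,-1)`, then along the ring). [folklore] -/
theorem exists_walk_zero_unitRingPt {t : ℕ} (ht : 1 ≤ t) (ht' : t ≤ 7) :
    ∃ q : (zdGraph 2).Walk 0 (unitRingPt t),
      ∀ v ∈ q.support, v = 0 ∨ ∃ k, 1 ≤ k ∧ (k ≤ t ∨ k ≤ 2) ∧ v = unitRingPt k := by
  interval_cases t
  · obtain ⟨W, hW⟩ := exists_unitRingWalk (c := 1) (d := 2) (by norm_num) (by norm_num)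
    refine exists_walk_zero_unitRingPt_aux (lo := 1) (hi := 2) (Or.inl rfl) le_rfl (Or.inr le_rfl)
      W.reverse fun v hv => hW v ?_
    rwa [SimpleGraph.Walk.support_reverse, List.mem_reverse] at hv
  · obtain ⟨W, hW⟩ := exists_unitRingWalk (c := 2) (d := 2) le_rfl (by norm_num)
    exact exists_walk_zero_unitRingPt_aux (Or.inl rfl) (by norm_num) (Or.inl le_rfl) W hW
  · obtain ⟨W, hW⟩ := exists_unitRingWalk (c := 2) (d := 3) (by norm_num) (by norm_num)
    exact exists_walk_zero_unitRingPt_aux (Or.inl rfl) (by norm_num) (Or.inl le_rfl) W hW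
  · obtain ⟨W, hW⟩ := exists_unitRingWalk (c := 4) (d := 4) le_rfl (by norm_num)
    exact exists_walk_zero_unitRingPt_aux (Or.inr (Or.inl rfl)) (by norm_num) (Or.inl le_rfl) W hW
  · obtain ⟨W, hW⟩ := exists_unitRingWalk (c := 4) (d := 5) (by norm_num) (by norm_num)
    exact exists_walk_zero_unitRingPt_aux (Or.inr (Or.inl rfl)) (by norm_num) (Or.inl le_rfl) W hW
  · obtain ⟨W, hW⟩ := exists_unitRingWalk (c := 6) (d := 6) le_rfl (by norm_num)
    exact exists_walk_zero_unitRingPt_aux (Or.inr (Or.inr rfl)) (by norm_num) (Or.inl le_rfl) W hW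
  · obtain ⟨W, hW⟩ := exists_unitRingWalk (c := 6) (d := 7) (by norm_num) (by norm_num)
    exact exists_walk_zero_unitRingPt_aux (Or.inr (Or.inr rfl)) (by norm_num) (Or.inl le_rfl) W hW

/-- The origin and the ring sites lie in `[-1,1]²`. [folklore] -/
theorem mem_box_one_of_eq_zero_or {v : Site 2} (h : v = 0 ∨ ∃ k, k < 8 ∧ v = unitRingPt k) :
    v ∈ box 2 1 := by
  rcases h with rfl | ⟨k, hk, rfl⟩
  · exact zero_mem_box 2 1
  · exact unitRingPt_mem_box k hk

/-- **Disjoint rooting walks.** For two distinct ring sites `unitRingPt k₁ ≠ unitRingPt k₂` there are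
lattice walks inside `[-1,1]²`, one from the origin to one of them and one from `e₀ = (1,0)` to
the other, with disjoint vertex sets. (If one of the sites is `e₀` it is docked trivially and the
origin walks to the other avoiding `e₀`; otherwise, with `k₁ < k₂`, `e₀` walks clockwise down to
`unitRingPt k₂` while `0` reaches `unitRingPt k₁` through indices `< k₂` — except for `{k₁, k₂} = {1, 2}`,
where `0 → (0,1)` and `e₀ → (1,1)`.) [folklore] -/
theorem exists_disjoint_rootingWalks {k₁ k₂ : ℕ} (hk₁ : k₁ < 8) (hk₂ : k₂ < 8) (hne : k₁ ≠ k₂) :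
    ∃ a b : ℕ, (a = k₁ ∧ b = k₂ ∨ a = k₂ ∧ b = k₁) ∧
      ∃ (Q₁ : (zdGraph 2).Walk 0 (unitRingPt a)) (Q₂ : (zdGraph 2).Walk (unitRingPt 0) (unitRingPt b)),
        (∀ v ∈ Q₁.support, v ∈ box 2 1) ∧ (∀ v ∈ Q₂.support, v ∈ box 2 1) ∧
          ∀ v ∈ Q₁.support, v ∉ Q₂.support := by
  wlog hlt : k₁ < k₂ generalizing k₁ k₂
  · obtain ⟨a, b, hab, rest⟩ := this hk₂ hk₁ hne.symm (by omega)
    exact ⟨a, b, hab.symm, rest⟩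
  by_cases h0 : k₁ = 0
  · -- `unitRingPt k₁ = e₀` is docked by the trivial walk; the origin is rooted at `unitRingPt k₂`
    subst h0
    obtain ⟨Q₁, hQ₁⟩ := exists_walk_zero_unitRingPt (t := k₂) (by omega) (by omega)
    refine ⟨k₂, 0, Or.inr ⟨rfl, rfl⟩, Q₁, SimpleGraph.Walk.nil, fun v hv => ?_, fun v hv => ?_,
      fun v hv hv' => ?_⟩
    · rcases hQ₁ v hv with h | ⟨k, -, hk, h⟩
      · exact mem_box_one_of_eq_zero_or (Or.inl h)
      · exact mem_box_one_of_eq_zero_or (Or.inr ⟨k, by omega, h⟩)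
    · rw [SimpleGraph.Walk.support_nil, List.mem_singleton] at hv
      exact mem_box_one_of_eq_zero_or (Or.inr ⟨0, by norm_num, hv⟩)
    · rw [SimpleGraph.Walk.support_nil, List.mem_singleton] at hv'
      rcases hQ₁ v hv with h | ⟨k, hk, hk', h⟩
      · exact unitRingPt_ne_zero 0 (by norm_num) (hv'.symm.trans h)
      · have := unitRingPt_injOn (by omega) (by norm_num) (h.symm.trans hv')
        omega
  by_cases h12 : k₁ = 1 ∧ k₂ = 2
  · -- the exceptional pair: `0 → (0,1) = unitRingPt 2`, `e₀ → (1,1) = unitRingPt 1`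
    obtain ⟨rfl, rfl⟩ := h12
    refine ⟨2, 1, Or.inr ⟨rfl, rfl⟩,
      SimpleGraph.Walk.cons (zero_adj_unitRingPt 2 (Or.inl rfl)) SimpleGraph.Walk.nil,
      SimpleGraph.Walk.cons (unitRingPt_adj_succ 0 (by norm_num)) SimpleGraph.Walk.nil,
      fun v hv => ?_, fun v hv => ?_, fun v hv hv' => ?_⟩
    · simp only [SimpleGraph.Walk.support_cons, SimpleGraph.Walk.support_nil, List.mem_cons,
        List.not_mem_nil, or_false] at hv
      rcases hv with rfl | rfl
      · exact zero_mem_box 2 1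
      · exact unitRingPt_mem_box 2 (by norm_num)
    · simp only [SimpleGraph.Walk.support_cons, SimpleGraph.Walk.support_nil, List.mem_cons,
        List.not_mem_nil, or_false] at hv
      rcases hv with rfl | rfl
      · exact unitRingPt_mem_box 0 (by norm_num)
      · exact unitRingPt_mem_box 1 (by norm_num)
    · simp only [SimpleGraph.Walk.support_cons, SimpleGraph.Walk.support_nil, List.mem_cons,
        List.not_mem_nil, or_false] at hv hv'
      rcases hv with rfl | rfl <;> rcases hv' with h | h
      · exact unitRingPt_ne_zero 0 (by norm_num) h.symm
      · exact unitRingPt_ne_zero 1 (by norm_num) h.symm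
      · exact absurd (unitRingPt_injOn (by norm_num) (by norm_num) h) (by norm_num)
      · exact absurd (unitRingPt_injOn (by norm_num) (by norm_num) h) (by norm_num)
  -- generic pair `1 ≤ k₁ < k₂`, `k₂ ≥ 3`
  have hk₂3 : 3 ≤ k₂ := by omega
  obtain ⟨Q₁, hQ₁⟩ := exists_walk_zero_unitRingPt (t := k₁) (by omega) (by omega)
  obtain ⟨Q₂, hQ₂⟩ := exists_walk_unitRingPt_zero (h := k₂) (by omega)
  refine ⟨k₁, k₂, Or.inl ⟨rfl, rfl⟩, Q₁, Q₂, fun v hv => ?_, fun v hv => ?_, fun v hv hv' => ?_⟩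
  · rcases hQ₁ v hv with h | ⟨k, -, hk, h⟩
    · exact mem_box_one_of_eq_zero_or (Or.inl h)
    · exact mem_box_one_of_eq_zero_or (Or.inr ⟨k, by omega, h⟩)
  · rcases hQ₂ v hv with h | ⟨k, -, hk, h⟩
    · exact mem_box_one_of_eq_zero_or (Or.inr ⟨0, by norm_num, h⟩)
    · exact mem_box_one_of_eq_zero_or (Or.inr ⟨k, by omega, h⟩)
  · rcases hQ₁ v hv with rfl | ⟨k, hk, hk', rfl⟩
    · rcases hQ₂ 0 hv' with h | ⟨k', -, hk', h⟩
      · exact unitRingPt_ne_zero 0 (by norm_num) h.symm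
      · exact unitRingPt_ne_zero k' (by omega) h.symm
    · rcases hQ₂ _ hv' with h | ⟨k', hk'₁, hk'₂, h⟩
      · have := unitRingPt_injOn (by omega) (by norm_num) h
        omega
      · have := unitRingPt_injOn (by omega) (by omega) h
        omega

/-! ### Sites of the sup-norm spheres are boundary sites -/

/-- A site of the sup-norm sphere `{‖v‖_∞ = N}` (`N ≥ 1`) lies on the vertex boundary of
`[-N,N]²`: stepping outwards in a saturated coordinate leaves the box. [folklore] -/
theorem mem_vertexBoundary_box_of_mem_siteSphere {N : ℕ} (hN : 1 ≤ N) {y : Site 2}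
    (hy : y ∈ siteSphere N) : y ∈ vertexBoundary (↑(box 2 N) : Set (Site 2)) := by
  rw [siteSphere, Finset.mem_sdiff] at hy
  obtain ⟨hyN, hyN'⟩ := hy
  refine ⟨Finset.mem_coe.2 hyN, ?_⟩
  rw [mem_box] at hyN hyN'
  push Not at hyN'
  obtain ⟨i, hi⟩ := hyN'
  have hyi := hyN i
  have hc : ((N - 1 : ℕ) : ℤ) = (N : ℤ) - 1 := by omega
  rw [hc] at hi
  by_cases hle : -((N : ℤ) - 1) ≤ y i
  · have hlt := hi hle
    refine ⟨y + Pi.single i 1, fun h => ?_, (zdGraph_adj_iff _ _).2 ⟨i, Or.inl rfl⟩⟩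
    have := (mem_box.1 (Finset.mem_coe.1 h) i).2
    simp only [Pi.add_apply, Pi.single_eq_same] at this
    omega
  · push Not at hle
    refine ⟨y - Pi.single i 1, fun h => ?_, (zdGraph_adj_iff _ _).2 ⟨i, Or.inr (by simp)⟩⟩
    have := (mem_box.1 (Finset.mem_coe.1 h) i).1
    simp only [Pi.sub_apply, Pi.single_eq_same] at this
    omega

/-! ### The modification window and the re-rooting surgery -/

/-- **The modification window**: the lattice edges of `ℤ²` with at least one endpoint in the box
`[-1,1]²`. [folklore] -/
def edgesNearOrigin : Finset (Sym2 (Site 2)) :=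
  (box 2 1).biUnion fun v => ((zdGraph 2).neighborFinset v).image fun u => s(v, u)

/-- Membership in the modification window. [folklore] -/
theorem mem_edgesNearOrigin_iff {e : Sym2 (Site 2)} :
    e ∈ edgesNearOrigin ↔ ∃ v ∈ box 2 1, ∃ u, (zdGraph 2).Adj v u ∧ s(v, u) = e := by
  simp only [edgesNearOrigin, Finset.mem_biUnion, Finset.mem_image, SimpleGraph.mem_neighborFinset]

/-- The modification window consists of lattice edges. [folklore] -/
theorem edgesNearOrigin_subset_edgeSet :
    (↑edgesNearOrigin : Set (Sym2 (Site 2))) ⊆ (zdGraph 2).edgeSet := by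
  intro e he
  obtain ⟨v, -, u, hvu, rfl⟩ := mem_edgesNearOrigin_iff.1 (Finset.mem_coe.1 he)
  exact (SimpleGraph.mem_edgeSet _).2 hvu

/-- A lattice edge with an endpoint in `[-1,1]²` belongs to the window. [folklore] -/
theorem mk_mem_edgesNearOrigin {a b : Site 2} (hab : (zdGraph 2).Adj a b)
    (h : a ∈ box 2 1 ∨ b ∈ box 2 1) : s(a, b) ∈ edgesNearOrigin := by
  rcases h with h | h
  · exact mem_edgesNearOrigin_iff.2 ⟨a, h, b, hab, rfl⟩
  · exact mem_edgesNearOrigin_iff.2 ⟨b, h, a, hab.symm, Sym2.eq_swap⟩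

/-- An edge of the window has an endpoint in `[-1,1]²`. [folklore] -/
theorem mem_box_or_of_mk_mem_edgesNearOrigin {a b : Site 2} (h : s(a, b) ∈ edgesNearOrigin) :
    a ∈ box 2 1 ∨ b ∈ box 2 1 := by
  obtain ⟨v, hv, u, -, he⟩ := mem_edgesNearOrigin_iff.1 h
  rcases Sym2.eq_iff.1 he with ⟨rfl, -⟩ | ⟨rfl, -⟩
  · exact Or.inl hv
  · exact Or.inr hv

/-- **The edges opened by the re-rooting surgery**: the two last steps `s(wᵢ, zᵢ)` of the arms and
the edges of the two rooting walks. [folklore] -/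
def rerootingEdges (w₁ z₁ w₂ z₂ : Site 2) {a₁ b₁ a₂ b₂ : Site 2} (Q₁ : (zdGraph 2).Walk a₁ b₁)
    (Q₂ : (zdGraph 2).Walk a₂ b₂) : Finset (Sym2 (Site 2)) :=
  insert s(w₁, z₁) (insert s(w₂, z₂) (Q₁.edges.toFinset ∪ Q₂.edges.toFinset))

/-- Membership in `rerootingEdges`. [folklore] -/
theorem mem_rerootingEdges_iff {w₁ z₁ w₂ z₂ a₁ b₁ a₂ b₂ : Site 2} {Q₁ : (zdGraph 2).Walk a₁ b₁}
    {Q₂ : (zdGraph 2).Walk a₂ b₂} {e : Sym2 (Site 2)} :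
    e ∈ rerootingEdges w₁ z₁ w₂ z₂ Q₁ Q₂ ↔
      e = s(w₁, z₁) ∨ e = s(w₂, z₂) ∨ e ∈ Q₁.edges ∨ e ∈ Q₂.edges := by
  simp only [rerootingEdges, Finset.mem_insert, Finset.mem_union, List.mem_toFinset]

/-- The opened edges lie in the window as soon as `z₁, z₂` and the rooting walks lie in `[-1,1]²`.
[folklore] -/
theorem rerootingEdges_subset {w₁ z₁ w₂ z₂ a₁ a₂ : Site 2} {Q₁ : (zdGraph 2).Walk a₁ z₁}
    {Q₂ : (zdGraph 2).Walk a₂ z₂} (hwz₁ : (zdGraph 2).Adj w₁ z₁) (hwz₂ : (zdGraph 2).Adj w₂ z₂)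
    (hQ₁ : ∀ v ∈ Q₁.support, v ∈ box 2 1) (hQ₂ : ∀ v ∈ Q₂.support, v ∈ box 2 1) :
    rerootingEdges w₁ z₁ w₂ z₂ Q₁ Q₂ ⊆ edgesNearOrigin := by
  intro e he
  rcases mem_rerootingEdges_iff.1 he with rfl | rfl | he | he
  · exact mk_mem_edgesNearOrigin hwz₁ (Or.inr (hQ₁ _ Q₁.end_mem_support))
  · exact mk_mem_edgesNearOrigin hwz₂ (Or.inr (hQ₂ _ Q₂.end_mem_support))
  · induction e using Sym2.ind with
    | h a b =>
      exact mk_mem_edgesNearOrigin ((SimpleGraph.mem_edgeSet _).1 (Q₁.edges_subset_edgeSet he))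
        (Or.inl (hQ₁ _ (Q₁.fst_mem_support_of_mem_edges he)))
  · induction e using Sym2.ind with
    | h a b =>
      exact mk_mem_edgesNearOrigin ((SimpleGraph.mem_edgeSet _).1 (Q₂.edges_subset_edgeSet he))
        (Or.inl (hQ₂ _ (Q₂.fst_mem_support_of_mem_edges he)))

/-- **The cut lemma along a walk**: if a set `C` of sites absorbs the far endpoint of every edge
of `ω'` inside `T` issued from `C`, then a walk inside `T` with edges in `ω'` starting in `C`
ends in `C`. [folklore] -/
theorem Rerooting.end_mem_of_closed {V : Type*} {G : SimpleGraph V} {C T : Set V}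
    {ω' : BondConfig V}
    (hC : ∀ a b : V, a ∈ C → a ∈ T → b ∈ T → s(a, b) ∈ ω' → G.Adj a b → b ∈ C) {u v : V}
    (R : G.Walk u v) (hu : u ∈ C) (hT : ∀ x ∈ R.support, x ∈ T) (hω : ∀ e ∈ R.edges, e ∈ ω') :
    v ∈ C := by
  induction R with
  | nil => exact hu
  | @cons a b c hab R ih =>
    refine ih (hC a b hu (hT a (by simp)) (hT b (by simp)) (hω _ (by simp)) hab)
      (fun x hx => hT x (by simp [hx])) (fun e he => hω e (by simp [he]))

/-- **An arm survives the surgery.** In the modified configuration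
`ω' = (ω ∖ window) ∪ opened`, a rooting walk `Q : s ⇝ z` inside `[-1,1]²` whose edges are opened
and which avoids the edge `s(0, e₀)`, followed by an opened step `z ← w` and an `ω`-open walk
`q : y ⇝ w` inside `[-N,N]² ∖ [-1,1]²`, joins `s` to `y` inside `[-N,N]²` without using `s(0, e₀)`.
[folklore] -/
theorem Rerooting.arm {N : ℕ} (hN : 1 ≤ N) {ω : BondConfig (Site 2)} {σ : Finset (Sym2 (Site 2))}
    {s z w y : Site 2} (Q : (zdGraph 2).Walk s z) (hQ : ∀ v ∈ Q.support, v ∈ box 2 1)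
    (hQσ : ∀ e ∈ Q.edges, e ∈ σ) (hQe : edgeFrom (0 : Site 2) 0 ∉ Q.edges)
    (hzw : (zdGraph 2).Adj z w) (hzwσ : s(z, w) ∈ σ)
    (q : (zdGraph 2).Walk y w) (hqN : ∀ v ∈ q.support, v ∈ box 2 N)
    (hqI : ∀ v ∈ q.support, v ∉ box 2 1) (hqω : ∀ e ∈ q.edges, e ∈ ω) :
    ((ω \ ↑edgesNearOrigin) ∪ ↑σ) \ {edgeFrom (0 : Site 2) 0} ∈
      openConnIn (↑(box 2 N) : Set (Site 2)) s y := by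
  have h0 : (0 : Site 2) ∈ box 2 1 := zero_mem_box 2 1
  have he₀ : (0 : Site 2) + Pi.single 0 1 ∈ box 2 1 := by
    rw [zero_add_single_zero_eq_pt]; exact pt_mem_box_one (by norm_num) le_rfl (by norm_num) zero_le_one
  refine mem_openConnIn_of_walk (Q.append (SimpleGraph.Walk.cons hzw q.reverse))
    (fun v hv => ?_) (fun e he => ?_)
  · rw [SimpleGraph.Walk.mem_support_append_iff, SimpleGraph.Walk.support_cons, List.mem_cons,
      SimpleGraph.Walk.support_reverse, List.mem_reverse] at hv
    rcases hv with hv | rfl | hv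
    · exact Finset.mem_coe.2 (box_mono 2 hN (hQ v hv))
    · exact Finset.mem_coe.2 (box_mono 2 hN (hQ _ Q.end_mem_support))
    · exact Finset.mem_coe.2 (hqN v hv)
  · rw [SimpleGraph.Walk.edges_append, List.mem_append, SimpleGraph.Walk.edges_cons,
      List.mem_cons, SimpleGraph.Walk.edges_reverse, List.mem_reverse] at he
    rcases he with he | rfl | he
    · exact ⟨Or.inr (Finset.mem_coe.2 (hQσ e he)), fun h => hQe (mem_singleton_iff.1 h ▸ he)⟩
    · refine ⟨Or.inr (Finset.mem_coe.2 hzwσ), fun h => ?_⟩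
      rw [mem_singleton_iff, edgeFrom, Sym2.eq_iff] at h
      rcases h with ⟨-, rfl⟩ | ⟨-, rfl⟩
      · exact hqI _ q.end_mem_support he₀
      · exact hqI _ q.end_mem_support h0
    · induction e using Sym2.ind with
      | h a b =>
        have ha : a ∉ box 2 1 := hqI a (q.fst_mem_support_of_mem_edges he)
        have hb : b ∉ box 2 1 := hqI b (q.snd_mem_support_of_mem_edges he)
        refine ⟨Or.inl ⟨hqω _ he, fun hF => ?_⟩, fun h => ?_⟩
        · rcases mem_box_or_of_mk_mem_edgesNearOrigin (Finset.mem_coe.1 hF) with h | h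
          · exact ha h
          · exact hb h
        · rw [mem_singleton_iff, edgeFrom, Sym2.eq_iff] at h
          rcases h with ⟨rfl, -⟩ | ⟨rfl, -⟩
          · exact ha h0
          · exact ha he₀

/-- **The re-rooting surgery.** Let `ω` be a lattice configuration and `N ≥ 1`. Suppose two
`ω`-open lattice walks `qᵢ : yᵢ ⇝ wᵢ` run inside `[-N,N]²` off `[-1,1]²`, from boundary sites `yᵢ`
of `[-N,N]²` to sites `wᵢ` adjacent to `zᵢ`, such that `w₁` and `w₂` are NOT joined by an
`ω`-open path of `[-N,N]² ∖ [-1,1]²`; and let `Q₁ : 0 ⇝ z₁`, `Q₂ : e₀ ⇝ z₂` be vertex-disjoint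
lattice walks inside `[-1,1]²`. Then the configuration obtained from `ω` by closing every edge of
the window `edgesNearOrigin` and opening `rerootingEdges` (the steps `s(wᵢ, zᵢ)` and the edges of
`Q₁, Q₂`) has four arms from the edge `s(0, e₀)` to `∂[-N,N]²` in the cluster form
`edgeFourArm [-N,N]² 0 0`: `0 ⇝ y₁` along `Q₁, z₁w₁, q₁`; `e₀ ⇝ y₂` likewise; and `0`, `e₀` are not
joined inside `[-N,N]²`, because the set `V(Q₁) ∪ {v | w₁ ⇝ v open in [-N,N]² ∖ [-1,1]²}`
contains `0`, absorbs every open edge of the new configuration issued from it, and misses `e₀`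
(Kesten 1987, §2: "connections inside a fixed finite box can be rearranged"; the cut argument
of `ZdPivotalFourArm.lean`). [folklore] -/
theorem mem_edgeFourArm_of_rerooting {N : ℕ} (hN : 1 ≤ N) {ω : BondConfig (Site 2)}
    (hω : ω ⊆ (zdGraph 2).edgeSet) {y₁ w₁ z₁ y₂ w₂ z₂ : Site 2}
    (hy₁ : y₁ ∈ vertexBoundary (↑(box 2 N) : Set (Site 2)))
    (hy₂ : y₂ ∈ vertexBoundary (↑(box 2 N) : Set (Site 2)))
    (q₁ : (zdGraph 2).Walk y₁ w₁) (hq₁N : ∀ v ∈ q₁.support, v ∈ box 2 N)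
    (hq₁I : ∀ v ∈ q₁.support, v ∉ box 2 1) (hq₁ω : ∀ e ∈ q₁.edges, e ∈ ω)
    (q₂ : (zdGraph 2).Walk y₂ w₂) (hq₂N : ∀ v ∈ q₂.support, v ∈ box 2 N)
    (hq₂I : ∀ v ∈ q₂.support, v ∉ box 2 1) (hq₂ω : ∀ e ∈ q₂.edges, e ∈ ω)
    (hsep : ω ∉ openConnIn ((↑(box 2 N) : Set (Site 2)) \ ↑(box 2 1)) w₁ w₂)
    (hwz₁ : (zdGraph 2).Adj w₁ z₁) (hwz₂ : (zdGraph 2).Adj w₂ z₂)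
    (Q₁ : (zdGraph 2).Walk 0 z₁) (Q₂ : (zdGraph 2).Walk ((0 : Site 2) + Pi.single 0 1) z₂)
    (hQ₁ : ∀ v ∈ Q₁.support, v ∈ box 2 1) (hQ₂ : ∀ v ∈ Q₂.support, v ∈ box 2 1)
    (hdisj : ∀ v ∈ Q₁.support, v ∉ Q₂.support) :
    (ω \ ↑edgesNearOrigin) ∪ ↑(rerootingEdges w₁ z₁ w₂ z₂ Q₁ Q₂) ∈
      edgeFourArm (↑(box 2 N) : Set (Site 2)) 0 0 := by
  -- names
  obtain ⟨σ, hσ⟩ : ∃ σ, σ = rerootingEdges w₁ z₁ w₂ z₂ Q₁ Q₂ := ⟨_, rfl⟩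
  obtain ⟨A', hA'⟩ : ∃ A' : Set (Site 2), A' = (↑(box 2 N) : Set (Site 2)) \ ↑(box 2 1) := ⟨_, rfl⟩
  rw [← hσ]
  rw [← hA'] at hsep
  have memσ : ∀ e, e ∈ σ ↔ e = s(w₁, z₁) ∨ e = s(w₂, z₂) ∨ e ∈ Q₁.edges ∨ e ∈ Q₂.edges :=
    fun e => by rw [hσ]; exact mem_rerootingEdges_iff
  have he₀box : (0 : Site 2) + Pi.single 0 1 ∈ box 2 1 := hQ₂ _ Q₂.start_mem_support
  have hz₂ : z₂ ∈ box 2 1 := hQ₂ _ Q₂.end_mem_support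
  have hw₁N : w₁ ∈ box 2 N := hq₁N _ q₁.end_mem_support
  have hw₁I : w₁ ∉ box 2 1 := hq₁I _ q₁.end_mem_support
  have hw₂I : w₂ ∉ box 2 1 := hq₂I _ q₂.end_mem_support
  have he₀Q₁ : (0 : Site 2) + Pi.single 0 1 ∉ Q₁.support := fun h => hdisj _ h Q₂.start_mem_support
  have h0Q₂ : (0 : Site 2) ∉ Q₂.support := fun h => hdisj _ Q₁.start_mem_support h
  -- the two arms
  refine ⟨⟨y₁, hy₁, ?_⟩, ⟨y₂, hy₂, ?_⟩, fun hconn => ?_⟩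
  · refine Rerooting.arm hN Q₁ hQ₁ (fun e he => (memσ e).2 (Or.inr (Or.inr (Or.inl he))))
      (fun h => he₀Q₁ (Q₁.snd_mem_support_of_mem_edges h)) hwz₁.symm
      ((memσ _).2 (Or.inl Sym2.eq_swap)) q₁ hq₁N hq₁I hq₁ω
  · refine Rerooting.arm hN Q₂ hQ₂ (fun e he => (memσ e).2 (Or.inr (Or.inr (Or.inr he))))
      (fun h => h0Q₂ (Q₂.fst_mem_support_of_mem_edges h)) hwz₂.symm
      ((memσ _).2 (Or.inr (Or.inl Sym2.eq_swap))) q₂ hq₂N hq₂I hq₂ω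
  -- the cut: `C = V(Q₁) ∪ (annulus cluster of w₁)` absorbs the open edges of the new configuration
  obtain ⟨C, hC⟩ : ∃ C : Set (Site 2), C = {v | v ∈ Q₁.support ∨ ω ∈ openConnIn A' w₁ v} :=
    ⟨_, rfl⟩
  have memC : ∀ v, v ∈ C ↔ v ∈ Q₁.support ∨ ω ∈ openConnIn A' w₁ v := fun v => by rw [hC]; rfl
  have memA' : ∀ v, v ∈ A' ↔ v ∈ box 2 N ∧ v ∉ box 2 1 := fun v => by rw [hA']; rfl
  have hA'of : ∀ {v}, ω ∈ openConnIn A' w₁ v → v ∉ box 2 1 := fun h => by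
    obtain ⟨-, hv, -⟩ := h
    exact ((memA' _).1 hv).2
  have hstep : ∀ a b : Site 2, a ∈ C → a ∈ (↑(box 2 N) : Set (Site 2)) → b ∈ (↑(box 2 N) : Set (Site 2)) →
      s(a, b) ∈ ((ω \ ↑edgesNearOrigin) ∪ ↑σ) \ {edgeFrom (0 : Site 2) 0} →
      (zdGraph 2).Adj a b → b ∈ C := by
    intro a b ha haN hbN hab hadj
    rw [Finset.mem_coe] at haN hbN
    obtain ⟨⟨habω, habF⟩ | habσ, -⟩ := hab
    · -- an untouched edge: both endpoints lie off `[-1,1]²`, inside the annulus cluster of `w₁`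
      have ha1 : a ∉ box 2 1 := fun h => habF (Finset.mem_coe.2 (mk_mem_edgesNearOrigin hadj (Or.inl h)))
      have hb1 : b ∉ box 2 1 := fun h => habF (Finset.mem_coe.2 (mk_mem_edgesNearOrigin hadj (Or.inr h)))
      have ha' : ω ∈ openConnIn A' w₁ a := by
        rcases (memC a).1 ha with ha | ha
        · exact absurd (hQ₁ a ha) ha1
        · exact ha
      exact (memC b).2 (Or.inr (PlanarDuality.openConnIn_trans ha'
        (openConnIn_of_adj ((memA' a).2 ⟨haN, ha1⟩) ((memA' b).2 ⟨hbN, hb1⟩) habω hadj.ne)))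
    · rcases (memσ _).1 (Finset.mem_coe.1 habσ) with h | h | h | h
      · -- the last step of the first arm: both endpoints are in `C`
        have hw₁C : w₁ ∈ C :=
          (memC _).2 (Or.inr (openConnIn_refl ((memA' _).2 ⟨hw₁N, hw₁I⟩)))
        have hz₁C : z₁ ∈ C := (memC _).2 (Or.inl Q₁.end_mem_support)
        rcases Sym2.eq_iff.1 h with ⟨-, rfl⟩ | ⟨-, rfl⟩
        · exact hz₁C
        · exact hw₁C
      · -- the last step of the second arm: `a ∈ {w₂, z₂}` is not in `C`
        exfalso
        have hz₂C : z₂ ∉ C := fun h' => by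
          rcases (memC _).1 h' with h' | h'
          · exact hdisj z₂ h' Q₂.end_mem_support
          · exact hA'of h' hz₂
        have hw₂C : w₂ ∉ C := fun h' => by
          rcases (memC _).1 h' with h' | h'
          · exact hw₂I (hQ₁ w₂ h')
          · exact hsep h'
        rcases Sym2.eq_iff.1 h with ⟨rfl, -⟩ | ⟨rfl, -⟩
        · exact hw₂C ha
        · exact hz₂C ha
      · -- an edge of the rooting walk of the origin
        exact (memC b).2 (Or.inl (Q₁.snd_mem_support_of_mem_edges h))
      · -- an edge of the rooting walk of `e₀`: `a` would lie on `Q₂`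
        exfalso
        have haQ₂ := Q₂.fst_mem_support_of_mem_edges h
        rcases (memC a).1 ha with ha | ha
        · exact hdisj a ha haQ₂
        · exact hA'of ha (hQ₂ a haQ₂)
  have hω'E : ((ω \ ↑edgesNearOrigin) ∪ ↑σ) \ {edgeFrom (0 : Site 2) 0} ⊆ (zdGraph 2).edgeSet :=
    sdiff_subset.trans (union_subset (sdiff_subset.trans hω)
      ((Finset.coe_subset.2 (hσ ▸ rerootingEdges_subset hwz₁ hwz₂ hQ₁ hQ₂)).trans
        edgesNearOrigin_subset_edgeSet))
  obtain ⟨R, hRN, hRω⟩ := exists_walk_of_mem_openConnIn hω'E hconn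
  have h0C : (0 : Site 2) ∈ C := (memC _).2 (Or.inl Q₁.start_mem_support)
  rcases (memC _).1 (Rerooting.end_mem_of_closed hstep R h0C hRN hRω) with h | h
  · exact he₀Q₁ h
  · exact hA'of h he₀box

/-- **The re-rooting surgery, packaged**: under the hypotheses of `mem_edgeFourArm_of_rerooting`
some set `σ` of window edges makes `(ω ∖ window) ∪ σ` a member of `edgeFourArm [-N,N]² 0 0`.
[folklore] -/
theorem exists_rerooting {N : ℕ} (hN : 1 ≤ N) {ω : BondConfig (Site 2)}
    (hω : ω ⊆ (zdGraph 2).edgeSet) {y₁ w₁ z₁ y₂ w₂ z₂ : Site 2}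
    (hy₁ : y₁ ∈ vertexBoundary (↑(box 2 N) : Set (Site 2)))
    (hy₂ : y₂ ∈ vertexBoundary (↑(box 2 N) : Set (Site 2)))
    (q₁ : (zdGraph 2).Walk y₁ w₁) (hq₁N : ∀ v ∈ q₁.support, v ∈ box 2 N)
    (hq₁I : ∀ v ∈ q₁.support, v ∉ box 2 1) (hq₁ω : ∀ e ∈ q₁.edges, e ∈ ω)
    (q₂ : (zdGraph 2).Walk y₂ w₂) (hq₂N : ∀ v ∈ q₂.support, v ∈ box 2 N)
    (hq₂I : ∀ v ∈ q₂.support, v ∉ box 2 1) (hq₂ω : ∀ e ∈ q₂.edges, e ∈ ω)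
    (hsep : ω ∉ openConnIn ((↑(box 2 N) : Set (Site 2)) \ ↑(box 2 1)) w₁ w₂)
    (hwz₁ : (zdGraph 2).Adj w₁ z₁) (hwz₂ : (zdGraph 2).Adj w₂ z₂)
    (Q₁ : (zdGraph 2).Walk 0 z₁) (Q₂ : (zdGraph 2).Walk ((0 : Site 2) + Pi.single 0 1) z₂)
    (hQ₁ : ∀ v ∈ Q₁.support, v ∈ box 2 1) (hQ₂ : ∀ v ∈ Q₂.support, v ∈ box 2 1)
    (hdisj : ∀ v ∈ Q₁.support, v ∉ Q₂.support) :
    ∃ σ : Finset (Sym2 (Site 2)), σ ⊆ edgesNearOrigin ∧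
      (ω \ ↑edgesNearOrigin) ∪ ↑σ ∈ edgeFourArm (↑(box 2 N) : Set (Site 2)) 0 0 :=
  ⟨_, rerootingEdges_subset hwz₁ hwz₂ hQ₁ hQ₂, mem_edgeFourArm_of_rerooting hN hω hy₁ hy₂ q₁ hq₁N
    hq₁I hq₁ω q₂ hq₂N hq₂I hq₂ω hsep hwz₁ hwz₂ Q₁ Q₂ hQ₁ hQ₂ hdisj⟩

end Literature.Probability.Percolation
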